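import Mathlib
import HarnessLib
import Summits.KontsevichZagierPeriods.Zeta5Search.TwoTaleWhippleMeasures
import Summits.KontsevichZagierPeriods.Zeta5Search.Denom.TwoTaleP15Bridge

/-!
# TwoTaleWhippleP15 — the P15 bookkeeping identity `TwoTaleP15Forms.formQ n = TwoTaleP15.qP15 n`, and both
kernel rungs from the single named input `WhippleRemark5` (or its restriction `WhippleRemark5Max` to `a₄ = max aᵢ`)

HONEST FRAMING: systematic search; no irrationality claim unless certified.

fam-measure (pub-zeta5), FAMILY.md §10.11, filing request fam-measure 4 (c).  `TwoTaleWhipple{,Measures}` reduced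
the growth inputs `WhippleP15` / `WhippleA` of the two kernel rungs to Zudilin's Remark 5 (`WhippleRemark5`: Whipple's
terminating nearly-poised `₄F₃(1)` ↔ Saalschützian `₅F₄(1)` transformation [Slater (2.4.2.3); Whipple 1926, §3.5]
written over the Literature's typed closed forms), at P15 MODULO the bookkeeping hypothesis
`hB : ∀ n ≥ 1, Denom.TwoTaleP15Forms.formQ n = TwoTaleP15.qP15 n` (fam-denom's directly typed first-tale
coefficient versus P1 g9's `qP15 n := Zudilin2014.formQZ (aP15 n) (bP15 n)`).  This file

* DISCHARGES `hB` — **`formQ_eq_qP15`** — from two landed identifications, fam-denom's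
  `Denom.TwoTaleP15Bridge.formQ_eq : Zudilin2014.formQ (pA n) (pB n) = formQ n` (over `ℚ`) and the Literature's
  `Zudilin2014.formQ_eq_cast : Admissible a b → formQ a b = formQZ a b`, with `aP15 n = pA n`, `bP15 n = pB n`;
  this is also the join between the kernel cells of `TwoTaleP15FirstTale/…` (stated for `qP15`) and fam-denom's
  `Inclusion` (stated for `formQ`);
* hence, with NO bookkeeping hypothesis: `whippleP15_iff'`, **`whippleP15_of_remark5'`** (`WhippleRemark5 →
  WhippleP15`), `formQ_eq_neg_qhat`, `coeffRate_of_remark5`, **`zetaTwo_exponent_le_of_remark5P15 :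
  Inclusion → Decay 29.10787 → WhippleRemark5 → ExponentLE (zetaValue 2) 5.0499 ∧ zetaTwo_irrationalityExponent_le`**
  (+ the robust `Decay 29.1 → … 5.0521`);
* introduces the RESTRICTED named input **`WhippleRemark5Max`** = `WhippleRemark5` for data with `a₁, a₂, a₃ ≤ a₄`
  (the regime of both rungs, and the regime in which the classical proof — finite Bailey transform + Pfaff–Saalschütz
  + Chu–Vandermonde, Slater §2.4.2 — runs with all rising factorials at POSITIVE integers: `(a₄−a₁+1)_r`,
  `(a₄−a₂+1)_r`, `(a₄−a₃+1)_N`), with `WhippleRemark5.toMax` and every consequence re-derived from it: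
  `whippleA_of_remark5Max`, `whippleP15_of_remark5Max`, **`zetaTwo_exponent_le_of_remark5MaxA : InclusionA →
  DecayA 13.229 → WhippleRemark5Max → ExponentLE (zetaValue 2) 5.2053`**, **`zetaTwo_exponent_le_of_remark5MaxP15 :
  Inclusion → Decay 29.10787 → WhippleRemark5Max → ExponentLE (zetaValue 2) 5.0499 ∧ …`** — so a proof of the
  restricted classical statement already feeds both rungs.
Named unproved inputs: `Inclusion(A)`, `Decay(A) c` (fam-denom) and `WhippleRemark5(Max)` (classical theorem, typed
not proved); nothing about `ζ(2)` is certified here.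
-/

namespace Summit.KontsevichZagierPeriods.Zeta5Search.TwoTaleWhipple

open Finset
open Literature.NumberTheory.Irrationality
open Literature.NumberTheory.Irrationality.Zudilin2014
open Summit.KontsevichZagierPeriods.Zeta5Search

/-! ### The P15 bookkeeping identity -/

/-- P1 g9's `aP15` IS fam-denom's `pA` (same body up to the name of the slope vector). -/
theorem aP15_eq_pA (n : ℕ) : TwoTaleP15.aP15 n = Denom.TwoTaleP15Bridge.pA n := by
  funext i; fin_cases i <;> rfl

/-- P1 g9's `bP15` IS fam-denom's `pB` (identical bodies). -/
theorem bP15_eq_pB (n : ℕ) : TwoTaleP15.bP15 n = Denom.TwoTaleP15Bridge.pB n := rfl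

/-- **The P15 bookkeeping identity**: fam-denom's directly typed first-tale coefficient `formQ n` equals the
Literature's typed closed form `qP15 n = formQZ (aP15 n) (bP15 n)` for every `n ≥ 1`. -/
theorem formQ_eq_qP15 {n : ℕ} (hn : 1 ≤ n) : Denom.TwoTaleP15Forms.formQ n = TwoTaleP15.qP15 n := by
  have h1 := Denom.TwoTaleP15Bridge.formQ_eq hn
  have h2 := Zudilin2014.formQ_eq_cast (TwoTaleP15.admissible hn)
  rw [aP15_eq_pA, bP15_eq_pB] at h2
  have h3 : (Denom.TwoTaleP15Forms.formQ n : ℚ) = (TwoTaleP15.qP15 n : ℚ) := by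
    rw [← h1, h2, TwoTaleP15.qP15, aP15_eq_pA, bP15_eq_pB]
  exact_mod_cast h3

/-- The bookkeeping identity in the quantified form used as hypothesis `hB` in `TwoTaleWhipple{,Measures}`. -/
theorem formQ_eq_qP15_all : ∀ n : ℕ, 1 ≤ n → Denom.TwoTaleP15Forms.formQ n = TwoTaleP15.qP15 n :=
  fun _ hn => formQ_eq_qP15 hn

/-! ### P15 consequences of `WhippleRemark5` with no bookkeeping hypothesis -/

/-- `WhippleP15 ↔ ∀ n ≥ 1, qP15 n = −qhatP15 n` — fam-measure's named input IS Remark 5 at the P15 data. -/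
theorem whippleP15_iff' :
    TwoTaleP15Growth.WhippleP15 ↔ ∀ n : ℕ, 1 ≤ n → TwoTaleP15.qP15 n = -TwoTaleP15.qhatP15 n :=
  whippleP15_iff formQ_eq_qP15_all

/-- **`WhippleRemark5 → WhippleP15`** (no further hypothesis). -/
theorem whippleP15_of_remark5' (hW : WhippleRemark5) : TwoTaleP15Growth.WhippleP15 :=
  whippleP15_of_remark5 formQ_eq_qP15_all hW

/-- Under `WhippleRemark5`: `formQ n = −qhat n` for every `n ≥ 1`. -/
theorem formQ_eq_neg_qhat (hW : WhippleRemark5) {n : ℕ} (hn : 1 ≤ n) :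
    Denom.TwoTaleP15Forms.formQ n = -((TwoTaleP15Growth.qhat n : ℕ) : ℤ) :=
  whippleP15_of_remark5' hW n hn

/-- Under `WhippleRemark5`: the growth input `CoeffRate C₁star` of fam-denom's `zetaTwo_exponent_le_of_inputs`. -/
theorem coeffRate_of_remark5 (hW : WhippleRemark5) :
    Denom.TwoTaleP15Forms.CoeffRate TwoTaleP15Growth.C₁star :=
  TwoTaleP15Growth.coeffRate_of_whipple (whippleP15_of_remark5' hW)

/-! ### The restricted named input `WhippleRemark5Max` (`a₄ = max aᵢ`) and both rungs from it -/

/-- **Named input, restricted form**: Remark 5 for data with `a₁, a₂, a₃ ≤ a₄` — the regime of both kernel rungs,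
in which Whipple's transformation [Slater (2.4.2.3) with `d = −N`, `N = b₄ − a₄ − 1`; parameters `f = a₄`,
`h = a₄ − a₁ + 1`, `a = a₄ − a₁ − a₂ + 1`, `g = a₄ − a₃ + 1`] has all its lower rising factorials at positive
integers.  Typed, NOT proved here. [cite: Zudilin2014ZetaTwo, Remark 5] -/
@[conjecture] def WhippleRemark5Max : Prop :=
  ∀ a₁ a₂ a₃ a₄ b₄ : ℤ, a₁ ≤ a₄ → a₂ ≤ a₄ → a₃ ≤ a₄ → Admissible (firstA a₁ a₂ a₃ a₄) (firstB a₁ a₂ a₄ b₄) →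
    formQZ (firstA a₁ a₂ a₃ a₄) (firstB a₁ a₂ a₄ b₄) = -formQTZ (hatA a₁ a₂ a₃ a₄ b₄) (hatB a₁ a₂ a₃ a₄ b₄)

/-- The unrestricted statement implies the restricted one. -/
theorem WhippleRemark5.toMax (hW : WhippleRemark5) : WhippleRemark5Max :=
  fun a₁ a₂ a₃ a₄ b₄ _ _ _ h => hW a₁ a₂ a₃ a₄ b₄ h

/-- `q_n = −q̂_n` at P15 from the restricted input (`13n+1, 11n+1, 9n+1 ≤ 15n+1`). -/
theorem qP15_eq_neg_qhatP15_ofMax (hW : WhippleRemark5Max) {n : ℕ} (hn : 1 ≤ n) :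
    TwoTaleP15.qP15 n = -TwoTaleP15.qhatP15 n := by
  unfold TwoTaleP15.qP15 TwoTaleP15.qhatP15
  rw [aP15_eq, bP15_eq, aT_eq, bT_eq]
  refine hW _ _ _ _ _ (by omega) (by omega) (by omega) ?_
  rw [← aP15_eq, ← bP15_eq]
  exact TwoTaleP15.admissible hn

/-- `q_n = −q̂_n` at rung A from the restricted input (`6n+1, 5n+1, 4n+1 ≤ 7n+1`). -/
theorem formQA_eq_neg_formQTZ_ofMax (hW : WhippleRemark5Max) {n : ℕ} (hn : 1 ≤ n) :
    Denom.TwoTaleR3Forms.formQA n = -formQTZ (aTA n) (bTA n) := by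
  unfold Denom.TwoTaleR3Forms.formQA
  rw [aRungA_eq, bRungA_eq, aTA_eq, bTA_eq]
  refine hW _ _ _ _ _ (by omega) (by omega) (by omega) ?_
  rw [← aRungA_eq, ← bRungA_eq]
  exact Denom.TwoTaleR3Forms.admissibleA hn

/-- **`WhippleRemark5Max → WhippleA`**. -/
theorem whippleA_of_remark5Max (hW : WhippleRemark5Max) : TwoTaleR3Growth.WhippleA := by
  intro n hn
  rw [formQA_eq_neg_formQTZ_ofMax hW hn, formQTZ_aTA_eq_qhatA]

/-- **`WhippleRemark5Max → WhippleP15`**. -/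
theorem whippleP15_of_remark5Max (hW : WhippleRemark5Max) : TwoTaleP15Growth.WhippleP15 :=
  whippleP15_iff'.2 fun _ hn => qP15_eq_neg_qhatP15_ofMax hW hn

section Packaged

open Literature.NumberTheory.Transcendental (zetaValue)
open Summit.KontsevichZagierPeriods.Zeta5Search.Denom.TwoTaleR3Forms (InclusionA DecayA)
open Summit.KontsevichZagierPeriods.Zeta5Search.Denom.TwoTaleP15Forms (Inclusion Decay)

/-- **P15: `Inclusion → Decay 29.10787 → WhippleRemark5 → μ(ζ(2)) ≤ 5.0499`** (and the 2014 record statement),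
bookkeeping hypothesis discharged.  Named unproved inputs: `Inclusion`, `Decay 29.10787` (fam-denom; both rest on
the missing zero (bmiss) at P15) and the classical `WhippleRemark5`. -/
theorem zetaTwo_exponent_le_of_remark5P15 (hI : Inclusion) (hD : Decay 29.10787) (hW : WhippleRemark5) :
    ExponentLE (zetaValue 2) 5.0499 ∧ Zudilin2014.zetaTwo_irrationalityExponent_le :=
  TwoTaleP15Growth.zetaTwo_exponent_le_of_whipple₃ hI hD (whippleP15_of_remark5' hW)

/-- P15, robust decay constant: `Inclusion → Decay 29.1 → WhippleRemark5 → μ(ζ(2)) ≤ 5.0521 ∧ record`. -/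
theorem zetaTwo_exponent_le_of_remark5P15_robust (hI : Inclusion) (hD : Decay 29.1) (hW : WhippleRemark5) :
    ExponentLE (zetaValue 2) 5.0521 ∧ Zudilin2014.zetaTwo_irrationalityExponent_le :=
  TwoTaleP15Growth.zetaTwo_exponent_le_of_whipple₃_robust hI hD (whippleP15_of_remark5' hW)

/-- **Rung A from the restricted input: `InclusionA → DecayA 13.229 → WhippleRemark5Max → μ(ζ(2)) ≤ 5.2053`.** -/
theorem zetaTwo_exponent_le_of_remark5MaxA (hI : InclusionA) (hD : DecayA 13.229) (hW : WhippleRemark5Max) :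
    ExponentLE (zetaValue 2) 5.2053 :=
  TwoTaleR3Growth.zetaTwo_exponent_le_of_whippleA₃ hI hD (whippleA_of_remark5Max hW)

/-- **P15 from the restricted input: `Inclusion → Decay 29.10787 → WhippleRemark5Max → μ(ζ(2)) ≤ 5.0499 ∧ record`.** -/
theorem zetaTwo_exponent_le_of_remark5MaxP15 (hI : Inclusion) (hD : Decay 29.10787) (hW : WhippleRemark5Max) :
    ExponentLE (zetaValue 2) 5.0499 ∧ Zudilin2014.zetaTwo_irrationalityExponent_le :=
  TwoTaleP15Growth.zetaTwo_exponent_le_of_whipple₃ hI hD (whippleP15_of_remark5Max hW)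

end Packaged

end Summit.KontsevichZagierPeriods.Zeta5Search.TwoTaleWhipple
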